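import Summits.AtomisticToContinuum.Crystallization.Theses.ReggeStarCoercivity
import Summits.AtomisticToContinuum.Crystallization.Theorems.ReggeStarCoercivityPeriodicStarCoercivityOfStarCoercivity
import Summits.AtomisticToContinuum.Crystallization.Theorems.ReggeStarCoercivityStarCoercivityPeriodisation
import HarnessLib

/-!
# Items 13600 and 13602 are one statement: `PeriodicStarCoercivity ↔ StarCoercivity`

Route `ReggeStarCoercivity` (sub-problem `Crystallization` of `AtomisticToContinuum`). The torus crux
`PeriodicStarCoercivity` (item stmt-AtomisticToContinuum-13602, `deps: StarCoercivity`) and the thesis X `StarCoercivity`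
(item stmt-AtomisticToContinuum-13600) imply each other with the SAME constant `g`: blocks of a periodic competitor are
finite near-competitors (`periodicStarCoercivity_of_starCoercivity`, landed, trial blocks on `ChargedEnergyGapNegative.Blocks`)
and the far periodisation of a finite competitor is a periodic competitor with the same defective fraction and no larger
energy per particle (`StarCoercivityPeriodisation.stub_periodicTransfer`, landed). This file only records the `Iff`
(registered sub-goal `stub_transferIff` of the line `pinned-equilibria-reduction`) so that `lean search` finds the
equivalence under one name; consequently every periodic competitor with a defective motif point caps the admissible `g` of
13600, and a proof or refutation of either item settles the other. [folklore]
-/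

noncomputable section

namespace Summit.AtomisticToContinuum.Crystallization.Theorems.ReggeStarCoercivityPeriodicStarCoercivity

/-- **Registered sub-goal `stub_transferIff`: `PeriodicStarCoercivity ↔ StarCoercivity`** (items 13602 ⇔ 13600, same `g`;
periodisation one way, trial blocks the other). Unconditional. [folklore] -/
theorem stub_transferIff :
    Summit.AtomisticToContinuum.Crystallization.Theses.ReggeStarCoercivity.PeriodicStarCoercivity ↔
      Summit.AtomisticToContinuum.Crystallization.Theses.ReggeStarCoercivity.StarCoercivity :=
  ⟨StarCoercivityPeriodisation.stub_periodicTransfer, periodicStarCoercivity_of_starCoercivity⟩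

/-- `PeriodicStarCoercivity ↔ StarCoercivity` (items 13602 ⇔ 13600), searchable name of `stub_transferIff`. [folklore] -/
theorem periodicStarCoercivity_iff_starCoercivity :
    Summit.AtomisticToContinuum.Crystallization.Theses.ReggeStarCoercivity.PeriodicStarCoercivity ↔
      Summit.AtomisticToContinuum.Crystallization.Theses.ReggeStarCoercivity.StarCoercivity :=
  stub_transferIff

end Summit.AtomisticToContinuum.Crystallization.Theorems.ReggeStarCoercivityPeriodicStarCoercivity

end
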